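import Mathlib

/-!
# A compactly contained sub-channel with a clean landing zone

Let `D ⊆ ℂ` be open and connected with `0 ∈ D`, and let the disc `ball βs r₀` (`βs ≥ 0` real,
`r₀ > 0`) lie in `D` while `D` has nothing to the right of the line `Re z = βs` except that disc
(`D ⊆ {Re z < βs} ∪ ball βs r₀`).  Then there are an open connected `D₀` and a compact `K₀` with
`0 ∈ D₀ ⊆ K₀ ⊆ D`, `ball βs (r₀/2) ⊆ D₀`, and the *clean landing* property: every `z ∈ D₀` with
`Re z ≥ βs` and `|Im z| < r₀/4` lies in `ball βs (r₀/2)`.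

Proof.  Join `0` to `βs` by a path `γ` in `D` and *fold it back* with the continuous map
`Φ z := min (Re z) βs + i Im z` (identity on `{Re z ≤ βs}`, horizontal projection onto the line
`Re z = βs` to the right of it).  Since every point of `D` to the right of the line lies in the disc,
`Φ` maps `D` into `D`, so `R := Φ ∘ γ([0,1])` is a compact connected subset of `D ∩ {Re z ≤ βs}`
containing `0` and `βs` (here `βs ≥ 0` is used: `Φ 0 = 0`).  Thicken: `cthickening ε₀ R ⊆ D` for some
`ε₀ > 0`; with `ε := min ε₀ (r₀/8)` put `D₀ := thickening ε R ∪ ball βs (r₀/2)` and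
`K₀ := cthickening ε R ∪ closedBall βs (r₀/2)`.  A point `z` within `ε` of `R ⊆ {Re ≤ βs}` with
`Re z ≥ βs` and `|Im z| < r₀/4` has `|Re z - βs| < ε`, hence `‖z - βs‖ < ε + r₀/4 < r₀/2`.
Pure plane topology; Mathlib only.

Remark.  Without `0 ≤ βs` the statement is false: for `βs = -3/5`, `r₀ = 1`, `D = ball βs 1` the
point `z = 0 ∈ D₀` has `Re z ≥ βs`, `Im z = 0`, but `‖0 - βs‖ = 3/5 ≥ 1/2`.
-/

namespace Summit.QuantumFields.YangMills.Theorems.FreeEnergyWindowChannel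

open Set Metric

/-- **Landing channel.**  If `D ⊆ ℂ` is open and connected, `0 ∈ D`, `0 < r₀`, `0 ≤ βs`,
`ball βs r₀ ⊆ D` and `D ⊆ {Re z < βs} ∪ ball βs r₀`, then there are an open connected `D₀` and a
compact `K₀` with `0 ∈ D₀ ⊆ K₀ ⊆ D`, `ball βs (r₀/2) ⊆ D₀`, and every `z ∈ D₀` with `βs ≤ Re z`
and `|Im z| < r₀/4` lies in `ball βs (r₀/2)`.  Construction: fold a path from `0` to `βs` in `D`
back into `{Re z ≤ βs}` with `z ↦ min (Re z) βs + i Im z`, thicken its (compact, connected) image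
by `ε = min ε₀ (r₀/8)` inside `D`, and add the half-size disc.  [folklore] -/
theorem stub_landingChannel :
    ∀ (D : Set ℂ), IsOpen D → IsConnected D → (0 : ℂ) ∈ D → ∀ (βs r₀ : ℝ), 0 < r₀ → 0 ≤ βs →
      Metric.ball (βs : ℂ) r₀ ⊆ D → D ⊆ {z : ℂ | z.re < βs} ∪ Metric.ball (βs : ℂ) r₀ →
      ∃ D₀ K₀ : Set ℂ, IsOpen D₀ ∧ IsConnected D₀ ∧ IsCompact K₀ ∧ (0 : ℂ) ∈ D₀ ∧ D₀ ⊆ K₀ ∧ K₀ ⊆ D ∧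
        Metric.ball (βs : ℂ) (r₀ / 2) ⊆ D₀ ∧
        ∀ z ∈ D₀, βs ≤ z.re → |z.im| < r₀ / 4 → z ∈ Metric.ball (βs : ℂ) (r₀ / 2) := by
  intro D hD hDc h0 βs r₀ hr₀ hβs hball hdisc
  -- a path from `0` to `βs` inside `D`
  have hβsD : (βs : ℂ) ∈ D := hball (mem_ball_self hr₀)
  have hpath : IsPathConnected D := hD.isConnected_iff_isPathConnected.1 hDc
  have hJ : JoinedIn D 0 (βs : ℂ) := hpath.joinedIn 0 h0 _ hβsD
  set γ : Path (0 : ℂ) (βs : ℂ) := hJ.somePath with hγ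
  have hγD : ∀ t, γ t ∈ D := hJ.somePath_mem
  -- the fold-back map `Φ z = min (Re z) βs + i Im z`
  obtain ⟨Φ, hΦre, hΦim, hΦc⟩ : ∃ Φ : ℂ → ℂ,
      (∀ z, (Φ z).re = min z.re βs) ∧ (∀ z, (Φ z).im = z.im) ∧ Continuous Φ :=
    ⟨fun z => ((min z.re βs : ℝ) : ℂ) + ((z.im : ℝ) : ℂ) * Complex.I, fun z => by simp,
      fun z => by simp, by fun_prop⟩
  have hΦfix : ∀ z : ℂ, z.re ≤ βs → Φ z = z := fun z hz =>
    Complex.ext (by rw [hΦre, min_eq_left hz]) (hΦim z)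
  -- `Φ` maps `D` into `D`: points of `D` to the right of `Re z = βs` lie in the disc, and the
  -- horizontal projection onto the line `Re z = βs` does not increase the distance to `βs`
  have hΦD : ∀ z ∈ D, Φ z ∈ D := by
    intro z hz
    rcases le_or_gt z.re βs with hle | hlt
    · rw [hΦfix z hle]; exact hz
    · have hzb : z ∈ ball (βs : ℂ) r₀ := by
        rcases hdisc hz with h | h
        · exact absurd h (not_lt.2 hlt.le)
        · exact h
      apply hball
      rw [mem_ball, Complex.dist_eq] at hzb ⊢
      calc ‖Φ z - βs‖ ≤ |(Φ z - βs).re| + |(Φ z - βs).im| := Complex.norm_le_abs_re_add_abs_im _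
        _ = |(z - βs).im| := by simp [hΦre, hΦim, min_eq_right hlt.le]
        _ ≤ ‖z - (βs : ℂ)‖ := Complex.abs_im_le_norm _
        _ < r₀ := hzb
  -- the folded path: a compact connected `R ⊆ D ∩ {Re z ≤ βs}` through `0` and `βs`
  obtain ⟨R, hRc, hRpre, hRD, h0R, hβR, hRre⟩ : ∃ R : Set ℂ, IsCompact R ∧ IsPreconnected R ∧
      R ⊆ D ∧ (0 : ℂ) ∈ R ∧ (βs : ℂ) ∈ R ∧ ∀ p ∈ R, p.re ≤ βs := by
    refine ⟨range (Φ ∘ γ), isCompact_range (hΦc.comp γ.continuous),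
      isPreconnected_range (hΦc.comp γ.continuous), ?_, ⟨0, ?_⟩, ⟨1, ?_⟩, ?_⟩
    · rintro _ ⟨t, rfl⟩
      exact hΦD _ (hγD t)
    · rw [Function.comp_apply, γ.source]
      exact hΦfix 0 (by simpa using hβs)
    · rw [Function.comp_apply, γ.target]
      exact hΦfix _ (by simp)
    · rintro _ ⟨t, rfl⟩
      rw [Function.comp_apply, hΦre]
      exact min_le_right _ _
  -- a closed thickening of `R` inside `D`, of radius at most `r₀ / 8`
  obtain ⟨ε₀, hε₀, hε₀D⟩ := hRc.exists_cthickening_subset_open hD hRD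
  obtain ⟨ε, hεpos, hεle, hεr⟩ : ∃ ε : ℝ, 0 < ε ∧ ε ≤ ε₀ ∧ ε ≤ r₀ / 8 :=
    ⟨min ε₀ (r₀ / 8), lt_min hε₀ (by positivity), min_le_left _ _, min_le_right _ _⟩
  have hsub : R ⊆ thickening ε R := self_subset_thickening hεpos _
  have hr2 : 0 < r₀ / 2 := by positivity
  refine ⟨thickening ε R ∪ ball (βs : ℂ) (r₀ / 2), cthickening ε R ∪ closedBall (βs : ℂ) (r₀ / 2),
    isOpen_thickening.union isOpen_ball, ?_, hRc.cthickening.union (isCompact_closedBall _ _),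
    Or.inl (hsub h0R), union_subset_union (thickening_subset_cthickening _ _) ball_subset_closedBall,
    union_subset ((cthickening_mono hεle _).trans hε₀D)
      ((closedBall_subset_ball (by linarith)).trans hball),
    subset_union_right, ?_⟩
  · -- connectedness: the thickening of the connected `R` is connected and meets the disc at `βs`
    refine ⟨⟨0, Or.inl (hsub h0R)⟩, ?_⟩
    have hthick : IsPreconnected (thickening ε R) := by
      refine isPreconnected_of_forall 0 fun z hz => ?_
      obtain ⟨y, hy, hzy⟩ := mem_thickening_iff.1 hz
      refine ⟨R ∪ ball y ε, union_subset hsub (ball_subset_thickening hy _), Or.inl h0R,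
        Or.inr (mem_ball.2 hzy), ?_⟩
      exact IsPreconnected.union y hy (mem_ball_self hεpos) hRpre (convex_ball y _).isPreconnected
    exact IsPreconnected.union (βs : ℂ) (hsub hβR) (mem_ball_self hr2) hthick
      (convex_ball _ _).isPreconnected
  · -- the clean landing property
    intro z hz hzre hzim
    rcases hz with hz | hz
    · obtain ⟨p, hp, hzp⟩ := mem_thickening_iff.1 hz
      have hpre : p.re ≤ βs := hRre p hp
      rw [Complex.dist_eq] at hzp
      have h1 : |(z - p).re| < ε := (Complex.abs_re_le_norm _).trans_lt hzp
      rw [Complex.sub_re, abs_lt] at h1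
      rw [mem_ball, Complex.dist_eq]
      calc ‖z - (βs : ℂ)‖ ≤ |(z - (βs : ℂ)).re| + |(z - (βs : ℂ)).im| :=
            Complex.norm_le_abs_re_add_abs_im _
        _ = |z.re - βs| + |z.im| := by simp
        _ < ε + r₀ / 4 := add_lt_add (abs_lt.2 ⟨by linarith, by linarith⟩) hzim
        _ ≤ r₀ / 2 := by linarith
    · exact hz

end Summit.QuantumFields.YangMills.Theorems.FreeEnergyWindowChannel
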